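import Summits.BirchSwinnertonDyer.BirchSwinnertonDyer.Theorems.EisensteinDepletionAtTwoStarOptBSFSigmaNodeFifteen
import Literature.NumberTheory.EllipticCurves.SerreOpenImageOrdinaryInertiaProofs
import HarnessLib

/-!
# Line `star` on crux E1M (stmt-BirchSwinnertonDyer-20341): the `15a1` shape has level `15` — WITHOUT Setzer's classification

Lead star-p1 GEN 19.  Theorems/…StarOptBSFSigmaNodeFifteen (GEN 17) closed the `+256`/`α = −34` clause of the MID-walk residue modulo the PRINT
`Setzer1975_primeConductor_rationalTwoTorsion`: from `Δ(W₀) = 50625 = 3⁴·5⁴` it derived `N ∣ 15` and then excluded the PRIME levels `3` and `5` by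
Setzer's classification of prime conductors with a rational point of order `2`.  The classification is not needed: `3` and `5` both DIVIDE the
minimal discriminant `50625` of the globally minimal `W₀`, so both are bad primes of `W₀` (good reduction at `p` of a globally minimal equation
means `p ∤ Δ_min`, tree `not_dvd_minimalDiscriminantInt_of_hasGoodReductionAtPrime'`, AEC VII.5.1(a)), so both divide the conductor of `W₀` and hence
the level `N` (`IsNewformOf.dvd_level_iff_dvd_conductorNorm`); with `N ∣ 15` this pins `N = 15`, contradicting `N = N_W ≠ 15`.

* `false_of_fifteenShape_free` — `false_of_fifteenShape` verbatim WITHOUT the Setzer binder.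

This removes the print `stub_setzer` from the `+256` branch of line `star` (v13); the `−256` branch (Cremona-17) is treated separately.
Fact-free (Faltings / modularity named facts are NOT used here); no `sorry`, no new definition; nothing here reads `r_an`; StarOptB / E1M / BSD are
NOT proved (PARTITION D-0054: none — r_an ≥ 2 axis S0; no S0 motion).
-/

set_option linter.dupNamespace false
set_option autoImplicit false

noncomputable section

open scoped Classical MatrixGroups
open CongruenceSubgroup
open WeierstrassCurve Literature.NumberTheory.EllipticCurves Literature.NumberTheory.EllipticCurves.Greenberg1999
open Literature.NumberTheory.EllipticCurves.ModularForms

namespace Summit.BirchSwinnertonDyer.BirchSwinnertonDyer.Theorems.DepletionAtTwo.SigmaNode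

/-- A prime dividing the minimal discriminant of a globally minimal newform curve divides the level of its newform:
`p ∣ Δ_min(W₀) ⇒ p` is a bad prime of `W₀` (AEC VII.5.1(a), tree `not_dvd_minimalDiscriminantInt_of_hasGoodReductionAtPrime'`) `⇒ p ∣ N_{W₀} ⇒ p ∣ N`.
[cite: SilvermanAEC2009, VII.5 Prop. 5.1 (a)] [cite: AtkinLehner1970, Thm. 3] -/
theorem dvd_level_of_dvd_minimalDiscriminantInt (W₀ : WeierstrassCurve ℚ) [W₀.IsElliptic] [W₀.IsGloballyMinimal]
    {N : ℕ} [NeZero N] (f : CuspForm (Gamma0 N) 2) (hW₀ : IsNewformOf W₀ f) {p : ℕ} (hp : p.Prime)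
    (hdvd : (p : ℤ) ∣ minimalDiscriminantInt W₀) : p ∣ N := by
  haveI : Fact p.Prime := ⟨hp⟩
  have hbad : ¬ W₀.HasGoodReductionAtPrime p := fun hgood ↦
    W₀.not_dvd_minimalDiscriminantInt_of_hasGoodReductionAtPrime' p hgood hdvd
  exact (hW₀.dvd_level_iff_dvd_conductorNorm hp).mpr ((W₀.dvd_conductorNorm_iff_not_hasGoodReductionAtPrime p).mpr hbad)

/-- **`+256` and `α = −34` on the lattice-optimal curve of a habitat class at squarefree level `N ≠ 15` is impossible — PRINT-FREE.**
`Δ(W₀) = 50625 = 3⁴·5⁴`; primes of `N` are bad for `W₀`, so divide `50625`, so are `3` or `5`; `N = N_W` squarefree ⇒ `N ∣ 15`; conversely `3 ∣ Δ_min(W₀)`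
and `5 ∣ Δ_min(W₀)` make `3` and `5` bad primes of `W₀`, so `15 ∣ N`; hence `N = 15`, contradicting `N_W ≠ 15`.  (`false_of_fifteenShape` without Setzer.)
[cite: SilvermanAEC2009, VII.5 Prop. 5.1 (a)] [cite: AtkinLehner1970, Thm. 3] -/
theorem false_of_fifteenShape_free
    (W : WeierstrassCurve ℚ) [W.IsElliptic] [W.IsGloballyMinimal]
    (h15 : W.conductorNorm ℤ ≠ 15) (hsf : Squarefree (W.conductorNorm ℤ))
    {N : ℕ} [NeZero N] (f : CuspForm (Gamma0 N) 2) (hW : IsNewformOf W f)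
    (W₀ : WeierstrassCurve ℚ) [W₀.IsElliptic] [W₀.IsGloballyMinimal] (hW₀ : IsNewformOf W₀ f)
    {x₀ : ℚ} (hx₀ : HasRationalTwoTorsionX W₀ x₀)
    (h256 : (W₀.b₂ + 12 * x₀) ^ 2 - 32 * (W₀.b₄ + x₀ * W₀.b₂ + 6 * x₀ ^ 2) = 256) (hα : W₀.b₂ + 12 * x₀ = -34) : False := by
  -- `Δ(W₀) = 50625`
  have h4 := four_mul_Δ_eq W₀ hx₀
  have hβ : W₀.b₄ + x₀ * W₀.b₂ + 6 * x₀ ^ 2 = 225 / 8 := by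
    have : (W₀.b₂ + 12 * x₀) ^ 2 = 1156 := by rw [hα]; norm_num
    linarith
  have hΔ : W₀.Δ = 50625 := by
    rw [h256, hβ] at h4; linarith
  have hΔint : minimalDiscriminantInt W₀ = 50625 := by
    have h := cast_minimalDiscriminantInt W₀
    rw [hΔ] at h
    exact_mod_cast h
  -- the level equals `N_W`, squarefree
  have hNW : N = W.conductorNorm ℤ := hW.level_eq_conductorNorm_of_squarefree hsf
  have hsqN : Squarefree N := by rw [hNW]; exact hsf
  -- primes of `N` are `3` or `5`, so `N ∣ 15`
  have hprimes : ∀ p : ℕ, p.Prime → p ∣ N → p = 3 ∨ p = 5 := by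
    intro p hp hpN
    haveI : Fact p.Prime := ⟨hp⟩
    have hpW₀ : p ∣ W₀.conductorNorm ℤ := (hW₀.dvd_level_iff_dvd_conductorNorm hp).mp hpN
    have hbad : ¬ W₀.HasGoodReductionAtPrime p := (W₀.dvd_conductorNorm_iff_not_hasGoodReductionAtPrime p).mp hpW₀
    have hdvd : (p : ℤ) ∣ minimalDiscriminantInt W₀ := by
      by_contra h
      exact hbad (hasGoodReductionAtPrime_of_not_dvd W₀ p h)
    rw [hΔint] at hdvd
    exact eq_three_or_five_of_prime_dvd hp (by exact_mod_cast hdvd)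
  have hN15 : N ∣ 15 := dvd_fifteen_of_squarefree hsqN hprimes
  -- `3` and `5` divide `Δ_min(W₀)`, so `15 ∣ N`
  have h3 : 3 ∣ N :=
    dvd_level_of_dvd_minimalDiscriminantInt W₀ f hW₀ Nat.prime_three (by rw [hΔint]; norm_num)
  have h5 : 5 ∣ N :=
    dvd_level_of_dvd_minimalDiscriminantInt W₀ f hW₀ Nat.prime_five (by rw [hΔint]; norm_num)
  have h15N : 15 ∣ N := (Nat.Coprime.mul_dvd_of_dvd_of_dvd (by norm_num) h3 h5 :)
  have hN : N = 15 := Nat.dvd_antisymm hN15 h15N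
  exact h15 (by rw [← hNW, hN])

end Summit.BirchSwinnertonDyer.BirchSwinnertonDyer.Theorems.DepletionAtTwo.SigmaNode

end
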